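import Summits.BirchSwinnertonDyer.BirchSwinnertonDyer.Theorems.TwoAdicConverseOrdLambdaHalfAtTwoShapiroDatumDefs
import HarnessLib

/-!
# Route `TwoAdicConverse` (rung S3), crux `OrdLambdaHalfAtTwo` (item stmt-BirchSwinnertonDyer-19556), line
# `kato-determinant-greenberg-two`, skeleton v4.5: the Shapiro-corrected Kato–Greenberg datum RE-KEYED — the Poitou–Tate map `δ` is
# `θ`-SEMILINEAR for a constant-fixing automorphism `θ` of `Λ` (triage r1-1 GEN 19 Δ19-2, repair R-b), and the v4.5 successors of stubs 4″/6″

Seat `cruxlead-stmt-BirchSwinnertonDyer-19556-g3` (LEAD PROVER, MODE LINE; HOME `run/shared/lean/pub/bsd-2adic/`; triage r1-1 GEN 19 Δ19-2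
`Cruxes/OrdLambdaHalfAtTwo/TRIAGE-r1-1.md`).  HONEST FRAMING (cell bsd-2adic): BSD is not proved by any of this; the crux `OrdLambdaHalfAtTwo` is NOT
proved here; nothing about any particular curve is asserted; no named fact is minted; one hypothesis structure, one conversion, two displayed binders
(named `Prop`s, nothing asserted).  The kernel theorems are in `…ThetaDatumKernel`.

## Why this file (v4.4 → v4.5: a `stub-misstated` repair, MODE LINE L4)

Triage r1-1 GEN 19 (Δ19-2, KEYING DEFECT; NOT a kill): the v4.3 datum `ShapiroKatoGreenbergDatum` (p679221) types the Poitou–Tate map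
`δ : 𝐇¹_loc ⧸ L → X_Gr` as `Λ`-LINEAR, but it crosses the LOCAL DUALITY: `J.H = 𝐇¹_loc` is the covariant, `κ`-keyed Iwasawa cohomology, while `X_Gr = DGr.X`
is a contragredient Pontryagin dual (`toDual_T_smul`) keyed by a `κK` that `IsCyclotomic` (a kernel condition) and `IsTopGenerator` leave free up to
`u ∈ ℤ₂^×`.  By the cell's convention (`Kato2004/IwasawaInvolutionTwistProofs`: duality from a Galois-invariant pairing sends `conj_g` to `(· ∘ conj_{g⁻¹})`;
key-`γ` data = `ι`-twist) the genuine Poitou–Tate map `J.H ⧸ L_true → ker(X_Gr ↠ X_fine)` is `θ`-SEMILINEAR, `θ = ι ∘ θ_u` (the Iwasawa involution composed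
with a unit twist), and `Λ`-linear at exactly ONE keying.  AS TYPED (∀ `κK γK`) the v4.3 ∃-supply 4″ forces `θ_u(P) ∼ P` for the distinguishing polynomial
`P` of `char X_Gr / char X_fine` and every unit `u` — unsuppliable in all likelihood (same CLASS of defect as Δ16-1: the TYPE of the supply hypothesis, not
the composition; `OrdLambdaHalfAtTwo_of` stays valid; `λ` is keying-blind).  REPAIR R-b (triage's recommendation, lead g3 ADOPTED): add the keying
automorphism `θ : Λ ≃+* Λ` with `θ (C c) = C c` as a field and make `δ` `θ`-semilinear; `π`, exactness, `katoIndex` unchanged.  Why R-b and not R-a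
(«hypothesis `κK = (κ ∘ res)⁻¹`, `δ` linear») or R-c («∃-keying in 4″»): R-b keeps the binders' quantifier prefix VERBATIM (every `κK`, `γK`), contains
R-a as the case `θ = RingEquiv.refl`, needs no local-duality sign lemma to be typed first, and costs the kernel nothing: a `θ`-semilinear bijection with
`θ_C` is `ℤ₂`-linear, so `λ(ker π) = λ(𝐇¹_loc ⧸ L)` (`…ThetaDatumKernel.lambdaInvariant_eq_of_semilinear_bijective`, the 12-line argument of
`IwasawaAlgebra.lambdaInvariant_eq_of_involSemilinear`) and `lambda_PT`, hPT, the transparency theorem and the `±`/minus-side readings go through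
unchanged.  Nothing of v4.3 is lost: every v4.3 datum is a v4.5 datum with `θ = refl` and the same `gD` (`ShapiroKatoGreenbergDatum.toTheta`), so the
new ∃-supply is IMPLIED BY the old one and the new ∀-divisibility IMPLIES the old one (kernel file).

## What is here

§1 `ThetaShapiroKatoGreenbergDatum … extends PinnedKatoCore …` — the v4.3 fields with `θ`, `θ_C` added and `δ` re-typed `θ`-semilinear.  §2 `gD`
(of the core), `ShapiroKatoGreenbergDatum.toTheta` (`θ := RingEquiv.refl`).  §3 the displayed binders `ThetaShapiroKatoGreenbergSupplyAtTwo` (4‴,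
construction / print grade) and `ThetaShapiroGreenbergDivisibilityAtTwo` (6‴, research — the line's unique conjecture-grade stub), VERBATIM the v4.3
binders with the structure replaced.

JUNK LEDGER for the new fields `θ`, `θ_C` (why the ∃ stays honest): `θ` is pinned at print level by `δ` being an injective `θ`-semilinear map between the
GENUINE `𝐇¹_loc ⧸ L` and the GENUINE `X_Gr` with `exact_δ_π`; every `λ`-statement of the line is `θ`-blind (`θ_C`); `gD` does not mention `θ`; the
transparency theorem keeps 6‴ datum-invariant (= the `λ`-main-conjecture pair for `(E, E^K)` at `2`).  Everything else as in the v4.3 / v4 JUNK LEDGERS.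

References: K. Kato, Astérisque 295 (2004) §12.2, Thm 12.5, 16.6, 17.11, §17.13 [Kato2004Asterisque]; R. Greenberg, LNM 1716 (1999) §1 p. 60 (the two
`Λ`-structures on a Pontryagin dual) [GreenbergLNM1716]; B. Perrin-Riou, Invent. Math. 115 (1994) (local duality and the involution) [PerrinRiou1994Invent];
R. Greenberg, V. Vatsal, Invent. Math. 142 (2000) §2 [GreenbergVatsal2000]; L. Washington, GTM 83, §13.2 [Washington1997]; triage r1-1 GEN 19
`TRIAGE-r1-1.md` Δ19-2 (crux commits 39898817dece, 446f8b65341a).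
-/

set_option linter.dupNamespace false
set_option autoImplicit false

noncomputable section

open scoped Classical NumberField
open WeierstrassCurve NumberField IsDedekindDomain Field CategoryTheory Function
open Literature.NumberTheory.EllipticCurves Literature.NumberTheory.EllipticCurves.Rank1Residual
open Literature.NumberTheory.EllipticCurves.Kato2004 Literature.NumberTheory.EllipticCurves.Kato2004.EulerSystemValues
open Literature.NumberTheory.GaloisRepresentations
open Summit.BirchSwinnertonDyer.Rank1Residual.X1.MuLambda (lam)
open Summit.BirchSwinnertonDyer.Rank1Residual.X11b (AcSelmer.bdpData AcSelmer.strictDatum)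

namespace Summit.BirchSwinnertonDyer.BirchSwinnertonDyer.Theorems.TwoAdicKatoDeterminant

/-! ## §1 The re-keyed Shapiro-corrected pinned Kato–Greenberg datum (v4.5) -/

/-- **Kato–Greenberg datum at `2` for `(E, K, w)` with pinned carriers, the Shapiro lattice and the KEYING automorphism** (skeleton v4.5 of line
`kato-determinant-greenberg-two`; the v4.3 datum `ShapiroKatoGreenbergDatum` RE-TYPED at its Poitou–Tate map after triage r1-1 Δ19-2, repair R-b).
The compact core plus: a lattice `L ≤ 𝐇¹_loc(T₂W)` with `range(loc_W ⊕ 𝐇¹(u_A)∘loc_A) ≤ L`, `2·L ≤ range` (intended `L = loc_w̄ H¹_Iw(K_Σ/K, T₂W)`), a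
ring automorphism `θ` of `Λ` fixing the constants (intended: the Iwasawa involution composed with the unit twist matching the keying of `κK`), the
Poitou–Tate triple `0 → 𝐇¹_loc ⧸ L →δ X_Gr →π X_fine → 0` with `δ` `θ`-SEMILINEAR and injective, `π` `Λ`-linear onto, exact at `X_Gr`, and Kato's index
identity.  Nothing asserted: a hypothesis structure whose inhabitation is the displayed binder `ThetaShapiroKatoGreenbergSupplyAtTwo`.
[cite: Kato2004Asterisque, Thm 12.5, §17.13 (shape only; nothing asserted)] [cite: GreenbergLNM1716, §1 p. 60 (the two Λ-structures on a dual; shape only)]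
[cite: GreenbergVatsal2000, §2 (shape only)] -/
structure ThetaShapiroKatoGreenbergDatum
    {W : WeierstrassCurve ℚ} [W.IsElliptic] [ContinuousSMul ℤ_[2] (W.tateModule 2)]
    {A : WeierstrassCurve ℚ} [A.IsElliptic] [ContinuousSMul ℤ_[2] (A.tateModule 2)]
    {κ : ZpExtension ℚ 2} {γ : absoluteGaloisGroup ℚ}
    (I_W : IwasawaH1Data W 2 κ γ) (I_A : IwasawaH1Data A 2 κ γ)
    {v : HeightOneSpectrum (𝓞 ℚ)} {γᵥ : absoluteGaloisGroup (v.adicCompletion ℚ)}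
    (J : LocalIwasawaH1Data κ v ((tateRep W 2).toLocal v) γᵥ)
    (J' : LocalIwasawaH1Data κ v (tateLocalOrdinaryRep W 2 v) γᵥ)
    (J_A : LocalIwasawaH1Data κ v ((tateRep A 2).toLocal v) γᵥ)
    (uA : ((tateRep A 2).toLocal v).toTopRep ⟶ ((tateRep W 2).toLocal v).toTopRep)
    (hsurj : Function.Surjective
      (κ.toContinuousMonoidHom.comp (resGalOfEmb (closureEmb (K := ℚ) (v.adicCompletion ℚ)))))
    (hγ : κ.IsTopGenerator γ)
    (hγᵥ : κ.IsTopGenerator (resGalOfEmb (closureEmb (K := ℚ) (v.adicCompletion ℚ)) γᵥ))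
    {K : Type} [Field K] [NumberField K] {κK : ZpExtension K 2} {γK : absoluteGaloisGroup K}
    {w : HeightOneSpectrum (𝓞 K)}
    (DGr : (W.baseChange K).GreenbergStrictSelmerDualData κK γK (AcSelmer.bdpData (MK W K) 2 w))
    (Dfi : (W.baseChange K).GreenbergStrictSelmerDualData κK γK (fineData W K))
    (L₀ L₀' : IwasawaAlgebra 2) (b b' : ℕ)
    extends PinnedKatoCore I_W I_A J J' J_A uA hsurj hγ hγᵥ L₀ L₀' where
  /-- The Shapiro lattice `L = loc_w̄ H¹_Iw(K_Σ/K, T₂W) ≤ 𝐇¹_loc(T₂W|_{Γ_{ℚ₂}})`. -/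
  L : Submodule (IwasawaAlgebra 2) J.H
  /-- `loc(𝐇¹_Γ(T₂W) ⊕ 𝐇¹_Γ(T₂A)) ≤ L` (`res 𝐇¹(T₂W) + res 𝐇¹(T₂A) = H⁺ + H⁻ ≤ H`). -/
  range_le : LinearMap.range ((I_W.loc J hsurj hγ hγᵥ).coprod (J_A.map uA J ∘ₗ I_A.loc J_A hsurj hγ hγᵥ)) ≤ L
  /-- `2·L ≤ loc(𝐇¹_Γ(T₂W) ⊕ 𝐇¹_Γ(T₂A))` (`2x = (x + σx) + (x − σx) ∈ H⁺ + H⁻` for `x ∈ H`). -/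
  two_smul_mem : ∀ y ∈ L, (2 : IwasawaAlgebra 2) • y ∈
    LinearMap.range ((I_W.loc J hsurj hγ hγᵥ).coprod (J_A.map uA J ∘ₗ I_A.loc J_A hsurj hγ hγᵥ))
  /-- The KEYING automorphism of `Λ` across the local duality (the Iwasawa involution `ι : γ ↦ γ⁻¹` composed with a unit twist; `RingEquiv.refl`
  at the one print-exact keying `κK = (κ ∘ res)⁻¹`). -/
  θ : IwasawaAlgebra 2 ≃+* IwasawaAlgebra 2
  /-- `θ` fixes the constants `ℤ₂ ⊂ Λ` (so `θ`-semilinear maps are `ℤ₂`-linear and `λ` is blind to `θ`). -/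
  θ_C : ∀ c : ℤ_[2], θ (PowerSeries.C c) = PowerSeries.C c
  /-- Poitou–Tate over `K_∞`: `𝐇¹_loc ⧸ L ↪ X_Gr`, `θ`-SEMILINEAR (`J.H` is `κ`-keyed/covariant, `X_Gr` contragredient). -/
  δ : (J.H ⧸ L) →ₛₗ[(θ : IwasawaAlgebra 2 →+* IwasawaAlgebra 2)] DGr.X
  /-- `δ` is injective. -/
  δ_injective : Function.Injective δ
  /-- Restriction of characters `X_Gr ↠ X_fine`. -/
  π : DGr.X →ₗ[IwasawaAlgebra 2] Dfi.X
  /-- `π` is surjective. -/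
  π_surjective : Function.Surjective π
  /-- Poitou–Tate: exactness at `X_Gr`. -/
  exact_δ_π : Function.Exact δ π
  /-- Kato's index identity (Thm 12.5 + §17.13 ⊗ ℚ at `2` for `W` and `A`) with `λ`-Shapiro for the fine dual over `K_∞`. -/
  katoIndex : lambdaInvariant 2 (I_W.H ⧸ Submodule.span (IwasawaAlgebra 2) {zW}) +
      lambdaInvariant 2 (I_A.H ⧸ Submodule.span (IwasawaAlgebra 2) {zA}) + (b + b') =
    lambdaInvariant 2 Dfi.X + (lam L₀ + lam L₀')


/-! ## §2 `gD` and the passage from the v4.3 datum (definitions only; the kernel theorems are in `…ThetaDatumKernel`) -/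

section Kernel

variable {W : WeierstrassCurve ℚ} [W.IsElliptic] [ContinuousSMul ℤ_[2] (W.tateModule 2)]
  {A : WeierstrassCurve ℚ} [A.IsElliptic] [ContinuousSMul ℤ_[2] (A.tateModule 2)]
  {κ : ZpExtension ℚ 2} {γ : absoluteGaloisGroup ℚ}
  {I_W : IwasawaH1Data W 2 κ γ} {I_A : IwasawaH1Data A 2 κ γ}
  {v : HeightOneSpectrum (𝓞 ℚ)} {γᵥ : absoluteGaloisGroup (v.adicCompletion ℚ)}
  {J : LocalIwasawaH1Data κ v ((tateRep W 2).toLocal v) γᵥ}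
  {J' : LocalIwasawaH1Data κ v (tateLocalOrdinaryRep W 2 v) γᵥ}
  {J_A : LocalIwasawaH1Data κ v ((tateRep A 2).toLocal v) γᵥ}
  {uA : ((tateRep A 2).toLocal v).toTopRep ⟶ ((tateRep W 2).toLocal v).toTopRep}
  {hsurj : Function.Surjective
    (κ.toContinuousMonoidHom.comp (resGalOfEmb (closureEmb (K := ℚ) (v.adicCompletion ℚ))))}
  {hγ : κ.IsTopGenerator γ}
  {hγᵥ : κ.IsTopGenerator (resGalOfEmb (closureEmb (K := ℚ) (v.adicCompletion ℚ)) γᵥ)}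
  {K : Type} [Field K] [NumberField K] {κK : ZpExtension K 2} {γK : absoluteGaloisGroup K}
  {w : HeightOneSpectrum (𝓞 K)}
  {DGr : (W.baseChange K).GreenbergStrictSelmerDualData κK γK (AcSelmer.bdpData (MK W K) 2 w)}
  {Dfi : (W.baseChange K).GreenbergStrictSelmerDualData κK γK (fineData W K)}
  {L₀ L₀' : IwasawaAlgebra 2} {b b' : ℕ}

namespace ThetaShapiroKatoGreenbergDatum

variable (S : ThetaShapiroKatoGreenbergDatum I_W I_A J J' J_A uA hsurj hγ hγᵥ DGr Dfi L₀ L₀' b b')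

/-- `gD` of a re-keyed datum is `gD` of its core: `λ(𝐇¹_loc ⧸ (Λ loc zW + Λ loc zA))` (it does not mention `θ`, `L`, `δ`, `π`).
[cite: Kato2004Asterisque, Thm 12.6 (shape only)] -/
def gD : ℕ := S.toPinnedKatoCore.gD

end ThetaShapiroKatoGreenbergDatum

namespace ShapiroKatoGreenbergDatum

variable (S : ShapiroKatoGreenbergDatum I_W I_A J J' J_A uA hsurj hγ hγᵥ DGr Dfi L₀ L₀' b b')

/-- **Every v4.3 Shapiro datum is a v4.5 re-keyed datum** with `θ := RingEquiv.refl Λ` (the `Λ`-linear `δ` read as `id`-semilinear): so the v4.5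
∃-supply is implied by the v4.3 one and the v4.5 ∀-divisibility implies the v4.3 one — the re-typing WEAKENS the supply hypothesis and loses nothing.
[cite: Kato2004Asterisque, §17.13 (shape only)] -/
def toTheta : ThetaShapiroKatoGreenbergDatum I_W I_A J J' J_A uA hsurj hγ hγᵥ DGr Dfi L₀ L₀' b b' where
  toPinnedKatoCore := S.toPinnedKatoCore
  L := S.L
  range_le := S.range_le
  two_smul_mem := S.two_smul_mem
  θ := RingEquiv.refl (IwasawaAlgebra 2)
  θ_C := fun _ ↦ rfl
  δ := { toFun := S.δ, map_add' := S.δ.map_add, map_smul' := fun a x ↦ S.δ.map_smul a x }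
  δ_injective := S.δ_injective
  π := S.π
  π_surjective := S.π_surjective
  exact_δ_π := S.exact_δ_π
  katoIndex := S.katoIndex

/-- `toTheta` preserves `gD`. [folklore] -/
theorem toTheta_gD : S.toTheta.gD = S.gD := rfl

end ShapiroKatoGreenbergDatum

end Kernel

/-! ## §3 Displayed binders: the v4.5 successors of the registered stubs 4″ and 6″ (named `Prop`s; nothing asserted) -/

/-- [construction / print grade, OPEN in the tree at `p = 2`] **Supply of the RE-KEYED Shapiro-corrected pinned Kato–Greenberg datum** (v4.5 successor of
`ShapiroKatoGreenbergSupplyAtTwo`, binders VERBATIM, structure replaced): in the habitat (β) with all choices made, there exist the prime `v = (2)`, a local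
lift of the topological generator, Kato's global modules, the local towers, a local untwisting `u_A` and a `ThetaShapiroKatoGreenbergDatum` over them with
the true shadows.  CONTENT: as for 4″ (Kato Thm 12.5 (1)(2) ⊗ ℚ and §17.13 at `p = 2` for `W` and `A`, (12.2.3), the Coleman map for `F⁻` with Thm 16.6 (2) /
Prop 17.11 at `2` — the per-curve package is the tree THEOREM `Kato2004.exists_zetaClass_colemanMinus_recLaw_index_two` (p681779) modulo its readings —,
`λ`-Shapiro for the fine duals, Poitou–Tate for the Greenberg structure over `K_∞` with the Shapiro lattice, NOW with the duality's keying automorphism `θ`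
explicit (TRUE with `θ = ι ∘ θ_u` for every `κK`, `γK`), the local untwisting at the split prime).  Implied by the v4.3 binder (`thetaSupply_of_shapiroSupply`).
[cite: Kato2004Asterisque, Thm 12.5, §17.13, Thm 16.6, Prop 17.11 (shape; the p = 2 reading is the stub's content)]
[cite: GreenbergLNM1716, §1 p. 60 (shape only)] -/
@[conjecture] def ThetaShapiroKatoGreenbergSupplyAtTwo : Prop :=
  ∀ (W : WeierstrassCurve ℚ) [W.IsElliptic] [W.IsGloballyMinimal],
    ¬ W.HasCM → GoodOrd W 2 → ¬ W.HasIrreducibleModPGaloisRep 2 →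
    ∀ (κ : ZpExtension ℚ 2) (γ : absoluteGaloisGroup ℚ),
      κ.IsCyclotomic → ∀ (hγ : κ.IsTopGenerator γ), IsCyclotomicVariable 2 γ → IsOrdinaryAt W 2 →
    ∀ [NeZero (W.conductorNorm ℤ)] (f : CuspForm (CongruenceSubgroup.Gamma0 (W.conductorNorm ℤ)) 2),
      ModularForms.IsNewformOf W f →
    ∀ (D : W.SelmerDualData κ γ) (L₀ : IwasawaAlgebra 2),
      iwasawaToPowerSeries 2 L₀ = padicLFunction f (unitRoot W 2 : ℚ_[2]) →
    ∀ (K : Type) [Field K] [NumberField K],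
      (IsImaginaryQuadratic K ∧ SatisfiesHeegnerHypothesis (2 * W.conductorNorm ℤ) K) →
    ∀ (A : WeierstrassCurve ℚ) [A.IsElliptic] [A.IsGloballyMinimal] (C : VariableChange ℚ),
      C • A = W.quadraticTwist ((NumberField.discr K : ℤ) : ℚ) → IsOrdinaryAt A 2 →
    ∀ [NeZero (A.conductorNorm ℤ)] (g : CuspForm (CongruenceSubgroup.Gamma0 (A.conductorNorm ℤ)) 2),
      ModularForms.IsNewformOf A g →
    ∀ (DA : A.SelmerDualData κ γ) (L₀' : IwasawaAlgebra 2),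
      iwasawaToPowerSeries 2 L₀' = padicLFunction g (unitRoot A 2 : ℚ_[2]) →
    ∀ (w : HeightOneSpectrum (𝓞 K)), ((2 : ℕ) : 𝓞 K) ∈ w.asIdeal →
    ∀ (κK : ZpExtension K 2) (γK : absoluteGaloisGroup K), κK.IsCyclotomic → κK.IsTopGenerator γK →
    ∀ (DGr : (W.baseChange K).GreenbergStrictSelmerDualData κK γK (AcSelmer.bdpData (MK W K) 2 w))
      (Dfi : (W.baseChange K).GreenbergStrictSelmerDualData κK γK (fineData W K)),
      Module.Finite (IwasawaAlgebra 2) DGr.X ∧ Module.IsTorsion (IwasawaAlgebra 2) DGr.X →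
    ∀ [ContinuousSMul ℤ_[2] (W.tateModule 2)] [ContinuousSMul ℤ_[2] (A.tateModule 2)],
    ∃ (v : HeightOneSpectrum (𝓞 ℚ)) (γᵥ : absoluteGaloisGroup (v.adicCompletion ℚ))
      (hsurj : Function.Surjective
        (κ.toContinuousMonoidHom.comp (resGalOfEmb (closureEmb (K := ℚ) (v.adicCompletion ℚ)))))
      (hγᵥ : κ.IsTopGenerator (resGalOfEmb (closureEmb (K := ℚ) (v.adicCompletion ℚ)) γᵥ))
      (I_W : IwasawaH1Data W 2 κ γ) (I_A : IwasawaH1Data A 2 κ γ)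
      (J : LocalIwasawaH1Data κ v ((tateRep W 2).toLocal v) γᵥ)
      (J' : LocalIwasawaH1Data κ v (tateLocalOrdinaryRep W 2 v) γᵥ)
      (J_A : LocalIwasawaH1Data κ v ((tateRep A 2).toLocal v) γᵥ)
      (uA : ((tateRep A 2).toLocal v).toTopRep ⟶ ((tateRep W 2).toLocal v).toTopRep),
      Nonempty (ThetaShapiroKatoGreenbergDatum I_W I_A J J' J_A uA hsurj hγ hγᵥ DGr Dfi L₀ L₀' D.lambda DA.lambda)

/-- [research, OPEN] **Greenberg divisibility at `2` over the RE-KEYED Shapiro-corrected pinned carriers** (v4.5 successor of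
`ShapiroGreenbergDivisibilityAtTwo`, binders VERBATIM, structure replaced): in the habitat (β), for every re-keyed Shapiro-corrected pinned Kato–Greenberg
datum with the true shadows, `gD ≤ λ(X_Gr)`.  TRANSPARENCY (`ThetaShapiroKatoGreenbergDatum.gD_le_lambda_iff`, kernel file; unchanged by the re-keying since
`λ` is `θ`-blind): datum by datum this is the `λ`-main-conjecture PAIR for `(E, E^K)` at `2`; it IMPLIES the v4.3 binder
(`shapiroDivisibility_of_thetaDivisibility`).  INTENDED ROUTE, BARRIERS: as for 6″ (skeleton docstring); in `GL(1)`/residual coordinates (p684036, p685421):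
`2^{gD + corank(Sel_w^Σ/Sel_w^∅)} · #X^Σ[2] ≤ #Sel_w^Σ(K_∞, E[2^∞])[2]`.  Nothing asserted; NOT in print at `p = 2`.
[cite: Kato2004Asterisque, Thm 17.4 (the other divisibility; shape only)] [cite: GreenbergVatsal2000, Thm (1.3) (GL(1) dévissage, p odd)]
[cite: BurungaleSkinnerTianWan2024, §4.3 (explicit reciprocity laws, p ≥ 3)] -/
@[conjecture] def ThetaShapiroGreenbergDivisibilityAtTwo : Prop :=
  ∀ (W : WeierstrassCurve ℚ) [W.IsElliptic] [W.IsGloballyMinimal],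
    ¬ W.HasCM → GoodOrd W 2 → ¬ W.HasIrreducibleModPGaloisRep 2 →
    ∀ (κ : ZpExtension ℚ 2) (γ : absoluteGaloisGroup ℚ),
      κ.IsCyclotomic → ∀ (hγ : κ.IsTopGenerator γ), IsCyclotomicVariable 2 γ → IsOrdinaryAt W 2 →
    ∀ [NeZero (W.conductorNorm ℤ)] (f : CuspForm (CongruenceSubgroup.Gamma0 (W.conductorNorm ℤ)) 2),
      ModularForms.IsNewformOf W f →
    ∀ (D : W.SelmerDualData κ γ) (L₀ : IwasawaAlgebra 2),
      iwasawaToPowerSeries 2 L₀ = padicLFunction f (unitRoot W 2 : ℚ_[2]) →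
    ∀ (K : Type) [Field K] [NumberField K],
      (IsImaginaryQuadratic K ∧ SatisfiesHeegnerHypothesis (2 * W.conductorNorm ℤ) K) →
    ∀ (A : WeierstrassCurve ℚ) [A.IsElliptic] [A.IsGloballyMinimal] (C : VariableChange ℚ),
      C • A = W.quadraticTwist ((NumberField.discr K : ℤ) : ℚ) → IsOrdinaryAt A 2 →
    ∀ [NeZero (A.conductorNorm ℤ)] (g : CuspForm (CongruenceSubgroup.Gamma0 (A.conductorNorm ℤ)) 2),
      ModularForms.IsNewformOf A g →
    ∀ (DA : A.SelmerDualData κ γ) (L₀' : IwasawaAlgebra 2),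
      iwasawaToPowerSeries 2 L₀' = padicLFunction g (unitRoot A 2 : ℚ_[2]) →
    ∀ (w : HeightOneSpectrum (𝓞 K)), ((2 : ℕ) : 𝓞 K) ∈ w.asIdeal →
    ∀ (κK : ZpExtension K 2) (γK : absoluteGaloisGroup K), κK.IsCyclotomic → κK.IsTopGenerator γK →
    ∀ (DGr : (W.baseChange K).GreenbergStrictSelmerDualData κK γK (AcSelmer.bdpData (MK W K) 2 w))
      (Dfi : (W.baseChange K).GreenbergStrictSelmerDualData κK γK (fineData W K)),
      Module.Finite (IwasawaAlgebra 2) DGr.X ∧ Module.IsTorsion (IwasawaAlgebra 2) DGr.X →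
    ∀ [ContinuousSMul ℤ_[2] (W.tateModule 2)] [ContinuousSMul ℤ_[2] (A.tateModule 2)]
      (v : HeightOneSpectrum (𝓞 ℚ)) (γᵥ : absoluteGaloisGroup (v.adicCompletion ℚ))
      (hsurj : Function.Surjective
        (κ.toContinuousMonoidHom.comp (resGalOfEmb (closureEmb (K := ℚ) (v.adicCompletion ℚ)))))
      (hγᵥ : κ.IsTopGenerator (resGalOfEmb (closureEmb (K := ℚ) (v.adicCompletion ℚ)) γᵥ))
      (I_W : IwasawaH1Data W 2 κ γ) (I_A : IwasawaH1Data A 2 κ γ)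
      (J : LocalIwasawaH1Data κ v ((tateRep W 2).toLocal v) γᵥ)
      (J' : LocalIwasawaH1Data κ v (tateLocalOrdinaryRep W 2 v) γᵥ)
      (J_A : LocalIwasawaH1Data κ v ((tateRep A 2).toLocal v) γᵥ)
      (uA : ((tateRep A 2).toLocal v).toTopRep ⟶ ((tateRep W 2).toLocal v).toTopRep)
      (S : ThetaShapiroKatoGreenbergDatum I_W I_A J J' J_A uA hsurj hγ hγᵥ DGr Dfi L₀ L₀' D.lambda DA.lambda),
      S.gD ≤ lambdaInvariant 2 DGr.X

end Summit.BirchSwinnertonDyer.BirchSwinnertonDyer.Theorems.TwoAdicKatoDeterminant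

end
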